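import Summits.QuantumFields.BalabanUV.Beta.GAN24.FineReadoutCauchyGlue
import Summits.QuantumFields.BalabanUV.Beta.GAN24.FineReadoutCauchyOfPieces
import Summits.QuantumFields.BalabanUV.Beta.GAN24.FineReadoutCauchyTail

/-!
# `BalabanUV.Beta.GAN24.FineReadoutCauchyOfParts` — «(N1-Cauchy)» PART S2: the REAL-ZONE RATE of the difference symbol from the matched-label bound (PART A) and the new-label tail (PART K)

**G-an2-4 FORMALISATION SWARM, b2b-balaban-gan24-formalise-leaf-17 (gen 11) — PART S2 (holder's assembly) of the located leaf «(N1-Cauchy)»**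
(division `HOME/b2b-balaban-gan24-formalise-leaf-17/g11/N1-CAUCHY-DIVISION.md` v2.1 §3, the team table of record).  NOT IN PRINT; OUR PROOF
ATTEMPT.  [folklore] bookkeeping (norms of the glue identity) + ONE tree estimate BY NAME (leaf-01's PART K).

HONEST FRAMING (verbatim): «discharging `BetaPertH` makes Bałaban's UV stability UNCONDITIONAL — a real constructive-QFT result;
it is NOT the continuum limit and NOT the Clay problem.»
HONEST DEPENDENCY (verbatim): «continuum YM on T⁴ ⇐ BetaPertH ∧ nine spine estimates (0/9 proved); BetaPertH ⇐ (D1) ∧ (D4) ∧ CAP+tail;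
G-an2-4 gates asym, D1 and NE2/3/4.»

## What is here
* §1 (generic `d`) `norm_pw_kSym_ofRealVec_le` (`‖pw (kSym N q m) (repZ ζ)‖ ≤ 1` at real `q`), `norm_scale_eq`, and **`norm_diffSym_ofRealVec_le`**:
  at a real momentum, `‖diffSym N N′ Lc κ l z q‖ ≤ Σ_m ‖matched term m‖ + (Lc^{d+1})⁻¹·N′^{d+2}·Σ_{r ∈ box Lc} Σ_{m′ ∈ newLabels N N′} ‖ampA′ m′ κ·pw‖`
  (the norm of PART S1's `FineReadoutCauchyGlue.diffSym_eq_matched_add_tail`).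
* §2 (`d = 3`, every `Lc ≥ 1`) **`realRate_of_matched`**: IF the matched-label terms are summable with total `≤ c_A·Lc^{−(n+1)}` at every real
  `q ∈ BZ ∖ {0}` (PART A's output — leaf-16's (A-rate)+(A-cell)+(A-bound) summed by `AliasPointSum`), THEN
  `∃ c ≥ 0, ∀ n κ l z, ∀ q ∈ BZ 4, ‖diffSym (Lc^(n+1)) (Lc^(n+2)) Lc κ l z (ofRealVec q)‖ ≤ c·(Lc⁻¹)^n`
  — the hypothesis `hR` of leaf-13's real-zone assembly `GAN24/FineReadoutCauchyReal` with `θ = Lc⁻¹`; the new-label tail is leaf-01's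
  `FineReadoutCauchyTail.exists_newLabels_tail` BY NAME, the zero momentum is reached by continuity
  (`FineReadoutCauchyOfPieces.continuous_diffSym_ofRealVec` + `FibreContinuity.norm_le_on_BZ_of_punctured'`).
Discharges NOTHING of `(hS, hSall)`; «(N1-Cauchy)» closes when PART A lands (then `hA` is a tree theorem).  0 sorry, axioms
{propext, Classical.choice, Quot.sound}.
-/

noncomputable section

open Complex Finset
open scoped Real BigOperators
open Literature.MathematicalPhysics.QuantumFieldTheory
open Literature.MathematicalPhysics.QuantumFieldTheory.Balaban1983to89
open Literature.MathematicalPhysics.QuantumFieldTheory.Balaban1983to89.Beta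
open Literature.Probability.LatticeModels (Site TorusSite Torus.proj)
open LatticeForm (repZ quo)
open B4Strip (Strip ofRealVec)
open B4ContourShift (BZ ofRealVec_mem_Strip)
open BlochFibreMatrix (Idx)
open AffineAveraging (box toSite)
open Summit.QuantumFields.BalabanUV.Beta.GAN24.CombesThomasFibre (fibInv)
open Summit.QuantumFields.BalabanUV.Beta.GAN24.FibreSymbols (pw)
open Summit.QuantumFields.BalabanUV.Beta.GAN24.FibreDFT (kFine)
open Summit.QuantumFields.BalabanUV.Beta.GAN24.FibreDFTDictionary (ampA)
open Summit.QuantumFields.BalabanUV.Beta.GAN24.AliasReindex (lift newLabels kSym)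
open Summit.QuantumFields.BalabanUV.Beta.GAN24.FineReadoutSum (norm_pw_repZ_le)
open Summit.QuantumFields.BalabanUV.Beta.GAN24.FibreContinuity (norm_le_on_BZ_of_punctured')
open Summit.QuantumFields.BalabanUV.Beta.GAN24.FineReadoutCauchyFrame (diffSym)
open Summit.QuantumFields.BalabanUV.Beta.GAN24.FineReadoutCauchyFold (boxW)
open Summit.QuantumFields.BalabanUV.Beta.GAN24.FineReadoutCauchyGlue (diffSym_eq_matched_add_tail pw_kFine_eq_pw_kSym)
open Summit.QuantumFields.BalabanUV.Beta.GAN24.FineReadoutCauchyOfPieces (continuous_diffSym_ofRealVec eq_zero_of_ofRealVec_eq_zero)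
open Summit.QuantumFields.BalabanUV.Beta.GAN24.FineReadoutCauchyTail (exists_newLabels_tail)

namespace Summit.QuantumFields.BalabanUV.Beta.GAN24.FineReadoutCauchyOfParts

variable {d : ℕ}

/-! ## §1 Norm bookkeeping of the glue identity at a real momentum -/

/-- [folklore] At a real momentum the plane wave of a centred alias momentum has norm `≤ 1` at a box representative. -/
theorem norm_pw_kSym_ofRealVec_le {N : ℕ} [NeZero N] (q : Fin (d + 1) → ℝ) (m zz : TorusSite (d + 1) N) :
    ‖pw (kSym N (ofRealVec q) m) (repZ zz)‖ ≤ 1 := by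
  rw [← pw_kFine_eq_pw_kSym]
  have him : ∀ i, |(ofRealVec q i).im| ≤ (0 : ℝ) := fun i => by simp [ofRealVec]
  have h := norm_pw_repZ_le (p := ofRealVec q) him m zz
  simpa using h

/-- [folklore] The norm of the cell-mean scale factor `(Lc^{d+1})⁻¹·N′^{d+2}`. -/
theorem norm_scale_eq (Lc N' : ℕ) : ‖(((Lc : ℂ) ^ (d + 1))⁻¹ * ((N' : ℂ) ^ (d + 2)))‖ = ((Lc : ℝ) ^ (d + 1))⁻¹ * (N' : ℝ) ^ (d + 2) := by
  rw [norm_mul, norm_inv, norm_pow, norm_pow, Complex.norm_natCast, Complex.norm_natCast]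

/-- [folklore] **THE NORM OF THE GLUE IDENTITY AT A REAL MOMENTUM**: matched terms summed in norm + the scaled new-label cell tail in norm. -/
theorem norm_diffSym_ofRealVec_le {N N' Lc : ℕ} [NeZero N] [NeZero N'] [NeZero Lc] (hN : N' = N * Lc) (q : Fin (d + 1) → ℝ)
    (κ l : Fin (d + 1)) (z : Site (d + 1)) :
    ‖diffSym N N' Lc κ l z (ofRealVec q)‖ ≤
      (∑ m : TorusSite (d + 1) N,
        ‖(((Lc : ℂ) ^ (d + 1))⁻¹ * ((N' : ℂ) ^ (d + 2)) *
            (boxW Lc (kFine (ofRealVec q) (lift N' m)) *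
              ampA (ofRealVec q) (fun i => fibInv N' i (Sum.inr (Sum.inr l)) (ofRealVec q)) (lift N' m) κ) -
          ((N : ℂ) ^ (d + 2)) * ampA (ofRealVec q) (fun i => fibInv N i (Sum.inr (Sum.inr l)) (ofRealVec q)) m κ)‖) +
      ((Lc : ℝ) ^ (d + 1))⁻¹ * (N' : ℝ) ^ (d + 2) *
        ∑ r ∈ box (d + 1) Lc, ∑ m' ∈ (newLabels N N' : Finset (TorusSite (d + 1) N')),
          ‖ampA (ofRealVec q) (fun i => fibInv N' i (Sum.inr (Sum.inr l)) (ofRealVec q)) m' κ *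
            pw (kFine (ofRealVec q) m') (repZ (Torus.proj N' ((Lc : ℤ) • z + toSite r)))‖ := by
  rw [diffSym_eq_matched_add_tail hN]
  refine (norm_add_le _ _).trans (add_le_add ?_ ?_)
  · refine (norm_sum_le _ _).trans (Finset.sum_le_sum fun m _ => ?_)
    rw [norm_mul]
    have h1 := norm_pw_kSym_ofRealVec_le (N := N) q m (Torus.proj N z)
    have h0 : 0 ≤ ‖(((Lc : ℂ) ^ (d + 1))⁻¹ * ((N' : ℂ) ^ (d + 2)) *
        (boxW Lc (kFine (ofRealVec q) (lift N' m)) *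
          ampA (ofRealVec q) (fun i => fibInv N' i (Sum.inr (Sum.inr l)) (ofRealVec q)) (lift N' m) κ) -
        ((N : ℂ) ^ (d + 2)) * ampA (ofRealVec q) (fun i => fibInv N i (Sum.inr (Sum.inr l)) (ofRealVec q)) m κ)‖ := norm_nonneg _
    nlinarith
  · rw [norm_mul, norm_scale_eq]
    refine mul_le_mul_of_nonneg_left ?_ (by positivity)
    exact (norm_sum_le _ _).trans (Finset.sum_le_sum fun r _ => norm_sum_le _ _)

/-! ## §2 `d = 3`: the real-zone rate from the matched-label bound -/

section Four

/-- [folklore] The number of points of a cell. -/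
theorem card_box_four (Lc : ℕ) : (box (3 + 1) Lc).card = Lc ^ (3 + 1) := by
  simp [AffineAveraging.box, Fintype.card_piFinset, Finset.card_range, Finset.prod_const, Finset.card_univ, Fintype.card_fin]

/-- [folklore] **THE REAL-ZONE RATE OF THE DIFFERENCE SYMBOL FROM THE MATCHED-LABEL BOUND** (`d = 3`, every `Lc ≥ 1`): if at every real
`q ∈ BZ ∖ {0}` the matched-label terms of the glue identity sum in norm to `≤ c_A·Lc^{−(n+1)}` (PART A), then
`‖diffSym (Lc^(n+1)) (Lc^(n+2)) Lc κ l z (ofRealVec q)‖ ≤ c·(Lc⁻¹)^n` on ALL of `BZ 4` with `c = (c_A + C_K)/Lc`, `C_K` the constant of leaf-01's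
new-label tail `FineReadoutCauchyTail.exists_newLabels_tail` — the hypothesis `hR` of the real-zone assembly `GAN24/FineReadoutCauchyReal` with `θ = Lc⁻¹`. -/
theorem realRate_of_matched (Lc : ℕ) [NeZero Lc] {cA : ℝ} (hcA : 0 ≤ cA)
    (hA : ∀ (n : ℕ) (κ l : Fin (3 + 1)) (z : Site (3 + 1)) (q : Fin (3 + 1) → ℝ), q ∈ BZ (3 + 1) → q ≠ 0 →
      ∑ m : TorusSite (3 + 1) (Lc ^ (n + 1)),
        ‖(((Lc : ℂ) ^ (3 + 1))⁻¹ * (((Lc ^ (n + 2) : ℕ) : ℂ) ^ (3 + 2)) *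
            (boxW Lc (kFine (ofRealVec q) (lift (Lc ^ (n + 2)) m)) *
              ampA (ofRealVec q) (fun i => fibInv (Lc ^ (n + 2)) i (Sum.inr (Sum.inr l)) (ofRealVec q)) (lift (Lc ^ (n + 2)) m) κ) -
          (((Lc ^ (n + 1) : ℕ) : ℂ) ^ (3 + 2)) *
            ampA (ofRealVec q) (fun i => fibInv (Lc ^ (n + 1)) i (Sum.inr (Sum.inr l)) (ofRealVec q)) m κ)‖ ≤
        cA * ((Lc : ℝ)⁻¹) ^ (n + 1)) :
    ∃ c : ℝ, 0 ≤ c ∧ ∀ (n : ℕ) (κ l : Fin (3 + 1)) (z : Site (3 + 1)), ∀ q ∈ BZ (3 + 1),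
      ‖diffSym (Lc ^ (n + 1)) (Lc ^ (n + 2)) Lc κ l z (ofRealVec q)‖ ≤ c * ((Lc : ℝ)⁻¹) ^ n := by
  obtain ⟨κ₁, C, hκ₁, hC, hT⟩ := exists_newLabels_tail (Lc := Lc)
  have hLc : (0 : ℝ) < Lc := by exact_mod_cast Nat.pos_of_ne_zero (NeZero.ne Lc)
  refine ⟨(cA + C) * (Lc : ℝ)⁻¹, by positivity, fun n κ l z => ?_⟩
  -- the bound on the punctured zone
  have hpunct : ∀ q ∈ BZ (3 + 1), q ≠ 0 →
      ‖diffSym (Lc ^ (n + 1)) (Lc ^ (n + 2)) Lc κ l z (ofRealVec q)‖ ≤ (cA + C) * (Lc : ℝ)⁻¹ * ((Lc : ℝ)⁻¹) ^ n := by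
    intro q hq hq0
    have hN : Lc ^ (n + 2) = Lc ^ (n + 1) * Lc := pow_succ Lc (n + 1)
    have h := norm_diffSym_ofRealVec_le (d := 3) hN q κ l z
    have hmatched := hA n κ l z q hq hq0
    -- the new-label tail, cell point by cell point
    have hp : ofRealVec q ∈ Strip (3 + 1) κ₁ := ofRealVec_mem_Strip hκ₁.le hq
    have htail : ∑ r ∈ box (3 + 1) Lc, ∑ m' ∈ (newLabels (Lc ^ (n + 1)) (Lc ^ (n + 2)) : Finset (TorusSite (3 + 1) (Lc ^ (n + 2)))),
        ‖ampA (ofRealVec q) (fun i => fibInv (Lc ^ (n + 2)) i (Sum.inr (Sum.inr l)) (ofRealVec q)) m' κ *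
          pw (kFine (ofRealVec q) m') (repZ (Torus.proj (Lc ^ (n + 2)) ((Lc : ℤ) • z + toSite r)))‖ ≤
        (Lc : ℝ) ^ (3 + 1) * (C * ((((Lc ^ (n + 2) : ℕ) : ℝ)) ^ 5)⁻¹ * ((Lc : ℝ)⁻¹) ^ (n + 1)) := by
      have hb : ∀ r ∈ box (3 + 1) Lc, ∑ m' ∈ (newLabels (Lc ^ (n + 1)) (Lc ^ (n + 2)) : Finset (TorusSite (3 + 1) (Lc ^ (n + 2)))),
          ‖ampA (ofRealVec q) (fun i => fibInv (Lc ^ (n + 2)) i (Sum.inr (Sum.inr l)) (ofRealVec q)) m' κ *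
            pw (kFine (ofRealVec q) m') (repZ (Torus.proj (Lc ^ (n + 2)) ((Lc : ℤ) • z + toSite r)))‖ ≤
          C * ((((Lc ^ (n + 2) : ℕ) : ℝ)) ^ 5)⁻¹ * ((Lc : ℝ)⁻¹) ^ (n + 1) :=
        fun r _ => hT n (ofRealVec q) hp l κ _
      refine (Finset.sum_le_sum hb).trans (le_of_eq ?_)
      rw [Finset.sum_const, card_box_four, nsmul_eq_mul]; push_cast; ring
    refine h.trans ?_
    have hN'pos : (0 : ℝ) < (((Lc ^ (n + 2) : ℕ) : ℝ)) := by
      have : 0 < Lc ^ (n + 2) := pow_pos (Nat.pos_of_ne_zero (NeZero.ne Lc)) _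
      exact_mod_cast this
    have hscale : ((Lc : ℝ) ^ (3 + 1))⁻¹ * (((Lc ^ (n + 2) : ℕ) : ℝ)) ^ (3 + 2) *
        ((Lc : ℝ) ^ (3 + 1) * (C * ((((Lc ^ (n + 2) : ℕ) : ℝ)) ^ 5)⁻¹ * ((Lc : ℝ)⁻¹) ^ (n + 1))) = C * ((Lc : ℝ)⁻¹) ^ (n + 1) := by
      field_simp
      ring
    have ht2 : ((Lc : ℝ) ^ (3 + 1))⁻¹ * (((Lc ^ (n + 2) : ℕ) : ℝ)) ^ (3 + 2) *
        ∑ r ∈ box (3 + 1) Lc, ∑ m' ∈ (newLabels (Lc ^ (n + 1)) (Lc ^ (n + 2)) : Finset (TorusSite (3 + 1) (Lc ^ (n + 2)))),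
          ‖ampA (ofRealVec q) (fun i => fibInv (Lc ^ (n + 2)) i (Sum.inr (Sum.inr l)) (ofRealVec q)) m' κ *
            pw (kFine (ofRealVec q) m') (repZ (Torus.proj (Lc ^ (n + 2)) ((Lc : ℤ) • z + toSite r)))‖ ≤ C * ((Lc : ℝ)⁻¹) ^ (n + 1) := by
      rw [← hscale]
      exact mul_le_mul_of_nonneg_left htail (by positivity)
    have hsum := add_le_add hmatched ht2
    refine hsum.trans (le_of_eq ?_)
    rw [pow_succ]; ring
  -- closure at the zero momentum by real continuity
  intro q hq
  exact norm_le_on_BZ_of_punctured' (continuous_diffSym_ofRealVec (Lc ^ (n + 1)) (Lc ^ (n + 2)) Lc κ l z) hpunct q hq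

end Four

end Summit.QuantumFields.BalabanUV.Beta.GAN24.FineReadoutCauchyOfParts

end
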